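import Mathlib
import HarnessLib

/-!
# The self-normalised reweighting estimator is strongly consistent (E4′, statistical half)

HONEST FRAMING: exact (Metropolis-corrected) sampling algorithms for lattice gauge theory;
figures of merit are autocorrelation/cost numbers at stated couplings and volumes; no
continuum-physics claim.

Venture `LatticeQCDFlow` (cell pub-lqcd), topic `Exactness`, FANOUT row 30 (lean-1); the
statistical half of E4′ of HOME/VENTURE-STATEMENT.md ("unbiasedness of the Jarzynski-reweighted
estimator `⟨O e^{−W}⟩/⟨e^{−W}⟩` — ratio estimator: CONSISTENCY, not unbiasedness — state
precisely").  The population identities are `jarzynski_reweighting` (`JarzynskiFinite.lean`),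
`snf_reweighting` (`StochasticFlows.lean`) and `flow_reweighting_lintegral`
(`FlowPushforward.lean`): `E[w f] = c · ⟨f⟩_target`, `E[w] = c` with the SAME constant
`c = Z_n/Z_0` (resp. the target normalisation).  This file adds the one probabilistic step, a
corollary of Mathlib's strong law of large numbers (Etemadi's pairwise-independent version,
`ProbabilityTheory.strong_law_ae`); NEW WORK of the cell, nothing cited as a fact.

* `ratio_estimator_consistent` — for two integrable, pairwise independent, identically
  distributed sequences `A i` (think `w_i f(X_i)`) and `B i` (think `w_i`) with `E[B 0] ≠ 0`,
  the ratio of partial sums `(Σ_{i<n} A i) / (Σ_{i<n} B i)` converges almost surely to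
  `E[A 0] / E[B 0]`.  With the identities above the limit IS the target expectation `⟨f⟩`:
  the reweighted flow / NE-MCMC / SNF estimator is strongly consistent for every model or
  protocol (its finite-`n` BIAS and variance — the ESS — are where the model quality enters;
  nothing here says the estimator is unbiased, it is not).
-/

namespace Summit.Ventures.LatticeQCDFlow.Exactness

open MeasureTheory ProbabilityTheory Filter Finset
open scoped Topology

/-- **Strong consistency of the self-normalised (ratio) estimator.**  If `A i` and `B i` are
integrable, pairwise independent and identically distributed in `i` (e.g. `A i = w_i · f(X_i)`,
`B i = w_i` for i.i.d. weighted samples), and `E[B 0] ≠ 0`, then almost surely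
`(Σ_{i<n} A i) / (Σ_{i<n} B i) → E[A 0] / E[B 0]` as `n → ∞`. -/
theorem ratio_estimator_consistent {Ω : Type*} {mΩ : MeasurableSpace Ω} {μ : Measure Ω}
    (A B : ℕ → Ω → ℝ) (hAi : Integrable (A 0) μ) (hBi : Integrable (B 0) μ)
    (hAind : Pairwise fun i j => IndepFun (A i) (A j) μ)
    (hBind : Pairwise fun i j => IndepFun (B i) (B j) μ)
    (hAid : ∀ i, IdentDistrib (A i) (A 0) μ μ) (hBid : ∀ i, IdentDistrib (B i) (B 0) μ μ)
    (hB0 : μ[B 0] ≠ 0) :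
    ∀ᵐ ω ∂μ, Tendsto (fun n : ℕ => (∑ i ∈ range n, A i ω) / (∑ i ∈ range n, B i ω)) atTop
      (𝓝 (μ[A 0] / μ[B 0])) := by
  filter_upwards [strong_law_ae A hAi hAind hAid, strong_law_ae B hBi hBind hBid] with ω hA hB
  simp only [smul_eq_mul] at hA hB
  refine (hA.div hB hB0).congr' ?_
  filter_upwards [eventually_ne_atTop 0] with n hn
  have hn' : ((n : ℝ))⁻¹ ≠ 0 := inv_ne_zero (Nat.cast_ne_zero.mpr hn)
  exact mul_div_mul_left _ _ hn'

/-- The same with the limit written as a target expectation: if `E[A 0] = c · m` and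
`E[B 0] = c` for a constant `c ≠ 0` (the population identities of reweighting: `c = Z_n/Z_0`,
`m = ⟨f⟩_target`), the ratio estimator converges almost surely to `m`. -/
theorem ratio_estimator_consistent' {Ω : Type*} {mΩ : MeasurableSpace Ω} {μ : Measure Ω}
    (A B : ℕ → Ω → ℝ) (hAi : Integrable (A 0) μ) (hBi : Integrable (B 0) μ)
    (hAind : Pairwise fun i j => IndepFun (A i) (A j) μ)
    (hBind : Pairwise fun i j => IndepFun (B i) (B j) μ)
    (hAid : ∀ i, IdentDistrib (A i) (A 0) μ μ) (hBid : ∀ i, IdentDistrib (B i) (B 0) μ μ)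
    {c m : ℝ} (hc : c ≠ 0) (hA0 : μ[A 0] = c * m) (hB0 : μ[B 0] = c) :
    ∀ᵐ ω ∂μ, Tendsto (fun n : ℕ => (∑ i ∈ range n, A i ω) / (∑ i ∈ range n, B i ω)) atTop
      (𝓝 m) := by
  have h := ratio_estimator_consistent A B hAi hBi hAind hBind hAid hBid (hB0 ▸ hc)
  rw [hA0, hB0, mul_div_cancel_left₀ _ hc] at h
  exact h

end Summit.Ventures.LatticeQCDFlow.Exactness
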